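import Summits.NavierStokesRegularity.NavierStokesRegularity.Theorems.HodographBetchovFastClassSqueezeMiddleStrain
import Summits.NavierStokesRegularity.NavierStokesRegularity.Theorems.HodographBetchovFastClassSqueezeWindowConverse
import Summits.NavierStokesRegularity.NavierStokesRegularity.Theorems.HodographBetchovClassBudgetsRegulariseAlgebra

/-!
# `FastClassSqueeze` (stmt-NavierStokesRegularity-15832) from the fast-class Betchov charge

Route `HodographBetchov`, crux 3.  The route's thesis (header of `Theses/HodographBetchov.lean`) and the
strategist's census (`Cruxes/FastClassSqueeze/STRATEGY-CENSUS.md` §4.7) name one quantity with an evolution law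
on the fast class: the **Betchov charge** of the fast fluid, the positive part of the pointwise split
`Q(t,x) := ⟪ω, ∇u ω⟫ − 4 det ∇u = −4 det S` (`S = ½(∇u + ∇uᵀ)`, `ClassBudgetsRegularise.inner_curl_sub_four_det`,
Betchov 1956) integrated over `{|u| > l}`.  This file proves the transfer "SqueezeToMiller" of the census
OUTRIGHT, so that a line cutting the crux at the charge has its transfer stub closed:

* `max_mid_pow_three_le` — the scalar core: for `a ≥ b ≥ c` with `a + b + c = 0`,
  `(b⁺)³ ≤ (−abc)⁺ / 2` (if `b > 0` then `−c = a + b ≥ 2b` and `a ≥ b`);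
* `middleStrain_pos_pow_three_le` — for a trace-free `A : ℝ³ →L ℝ³` with middle principal strain
  `λ₂ = strainEigenvalues A _ 1` (the tree's `Literature.Analysis.FluidPDE.strainEigenvalues`, no new definition):
  `(λ₂⁺)³ ≤ (−det S)⁺ / 2` (orthonormal eigenbasis of `A + A†`, as in `ClassBudgetsRegularise.neg_det_strain_le`);
* `middleStrain_pos_pow_three_le_charge` — at a point with `div v = 0`: `(λ₂(∇v)⁺)³ ≤ Q⁺ / 8`;
* `window_of_charge` — ONE FLOW: if `∫₀ᵀ ∫_{|u(t)|>l} Q⁺ dx dt < ∞` at some level `l > 0`, then the crux's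
  conclusion holds for this flow in the `q = 3` window with the majorant `m = λ₂⁺`
  (`(∫_F (λ₂⁺)³)^{2/3} ≤ 1 + ∫_F (λ₂⁺)³ ≤ 1 + ∫_F Q⁺` slice by slice, and `(0,T)` has finite measure);
* `fastClassSqueeze_of_fastClassCharge` — the global transfer `FastClassCharge → FastClassSqueeze`;
* `pointSubscaleSqueeze_of_fastClassCharge` — the charge also closes the open registered stub
  `stub_pointSubscaleSqueeze` of line `Sketch-ideasK1` (through the landed window converse
  `GermWeyl.pointSubscaleSqueeze_of_fastClassSqueezeWindow`, `q = 3 ≥ 3`);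
* `window_of_criticalCharge`, `fastClassSqueeze_of_criticalFastClassCharge` (§4) — the same from the
  SCALE-INVARIANT form of the charge hypothesis, `∫₀ᵀ (∫_{|u(t)|>l} Q⁺ dx)^{2/3} dt < ∞` (no loss: this is the
  `q = 3`, `p = 2` Miller member of `(Q⁺)^{1/3} ≥ 2^{1/3} λ₂⁺`); the `L¹` form implies it on the finite interval.

`FastClassCharge` is written inline (it is not a route item): along every flow of the crux,
`∃ l > 0, ∫⁻_{(0,T)} ∫⁻_{{l<|u(t)|}} ofReal Q(t,x) < ⊤` (`ofReal` clips `Q` at `0`, so this is the positive charge).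
It is a-priori OPEN like the crux and necessary for regularity (bounded flows have an empty high fast class); its
only merit is the evolution law of `∫_F Q` through the class ledger.  CAVEAT ON SCALING: the `L¹_t L¹_x` charge is
NOT scale-invariant (under `u ↦ μ u(μ² t, μ x)` it scales like `μ`), so it is STRONGER than the crux: along a
self-similar-rate collapse its slices grow like `(T−t)^{-3/2}` (power divergence) where the crux's functional is only
log-divergent.  The scale-invariant charge statement is the `2/3`-power form of §4, equivalent in strength to the
`q = 3` window of the crux up to the pointwise inequality `(λ₂⁺)³ ≤ Q⁺/8`.
-/

noncomputable section

-- the summit and its single problem share the name `NavierStokesRegularity` (D-0017 nested layout)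
set_option linter.dupNamespace false

namespace Summit.NavierStokesRegularity.NavierStokesRegularity.Theorems.FastClassSqueeze.Charge

open Set MeasureTheory Filter Topology Metric Literature.Analysis Literature.Analysis.FluidPDE
open Summit.NavierStokesRegularity.NavierStokesRegularity.Theorems.ClassBudgetsRegularise
open scoped ENNReal NNReal InnerProductSpace RealInnerProductSpace

/-! ### §1 Algebra: the middle principal strain against the Betchov charge -/

/-- **Scalar core.** For `a ≥ b` and `c` with `a + b + c = 0`: `(b⁺)³ ≤ (−abc)⁺ / 2` (if `b > 0` then
`−abc = ab(a+b)` and `ab(a+b) − 2b³ = b(a−b)(a+2b) ≥ 0`; the ordering `b ≥ c` is not even needed). [folklore] -/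
theorem max_mid_pow_three_le {a b c : ℝ} (hab : b ≤ a) (hsum : a + b + c = 0) :
    max b 0 ^ 3 ≤ max (-(a * b * c)) 0 / 2 := by
  rcases le_or_gt b 0 with hb | hb
  · rw [max_eq_right hb]
    have := le_max_right (-(a * b * c)) 0
    linarith
  · rw [max_eq_left hb.le]
    have hc : c = -(a + b) := by linarith
    have h1 : 0 ≤ b * (a - b) * (a + 2 * b) :=
      mul_nonneg (mul_nonneg hb.le (sub_nonneg.2 hab)) (by linarith)
    have h2 : b ^ 3 ≤ -(a * b * c) / 2 := by rw [hc]; nlinarith [h1]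
    exact h2.trans (div_le_div_of_nonneg_right (le_max_left _ _) (by norm_num))

/-- **The middle principal strain against `−det S`.** For a trace-free `A : ℝ³ →L ℝ³` with principal strains
`λ₀ ≥ λ₁ ≥ λ₂` (eigenvalues of `S = ½(A + A†)`, `Σ λᵢ = tr A = 0`, `det S = λ₀λ₁λ₂`; only `λ₀ ≥ λ₁` is used):
`(λ₁⁺)³ ≤ (−det S)⁺ / 2`. [cite: Miller2019, Lemma 5.1] -/
theorem middleStrain_pos_pow_three_le (A : EuclideanSpace ℝ (Fin 3) →L[ℝ] EuclideanSpace ℝ (Fin 3))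
    (htr : LinearMap.trace ℝ _ (A : EuclideanSpace ℝ (Fin 3) →ₗ[ℝ] EuclideanSpace ℝ (Fin 3)) = 0) :
    max (strainEigenvalues (A : EuclideanSpace ℝ (Fin 3) →ₗ[ℝ] EuclideanSpace ℝ (Fin 3))
        finrank_euclideanSpace_fin 1) 0 ^ 3 ≤
      max (-((1 / 2 : ℝ) • (A + ContinuousLinearMap.adjoint A)).det) 0 / 2 := by
  set AL : EuclideanSpace ℝ (Fin 3) →ₗ[ℝ] EuclideanSpace ℝ (Fin 3) :=
    (A : EuclideanSpace ℝ (Fin 3) →ₗ[ℝ] EuclideanSpace ℝ (Fin 3)) with hAL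
  have h3 : Module.finrank ℝ (EuclideanSpace ℝ (Fin 3)) = 3 := finrank_euclideanSpace_fin
  have hT := isSymmetric_addAdjoint AL
  set μ : Fin 3 → ℝ := hT.eigenvalues h3 with hμ
  set b := hT.eigenvectorBasis h3 with hb
  -- the middle principal strain is `μ 1 / 2`
  have hmid : strainEigenvalues AL finrank_euclideanSpace_fin 1 = μ 1 / 2 := by
    rw [strainEigenvalues_def]
    change 2⁻¹ * μ 1 = μ 1 / 2
    ring
  -- ordering and trace
  have h01 : μ 1 ≤ μ 0 := hT.eigenvalues_antitone h3 (by decide : (0 : Fin 3) ≤ 1)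
  have hTb : ∀ i, addAdjoint AL (b i) = μ i • b i := fun i => hT.apply_eigenvectorBasis h3 i
  have hsum : μ 0 + μ 1 + μ 2 = 0 := by
    have h1 : LinearMap.trace ℝ _ (addAdjoint AL) = ∑ i, μ i := by
      rw [LinearMap.trace_eq_sum_inner _ b]
      refine Finset.sum_congr rfl fun i _ => ?_
      rw [hTb, real_inner_smul_right, real_inner_self_eq_norm_sq, b.orthonormal.1 i]; ring
    have h2 : LinearMap.trace ℝ _ (addAdjoint AL) = 2 * LinearMap.trace ℝ _ AL := by
      rw [LinearMap.trace_eq_sum_inner (addAdjoint AL) b, LinearMap.trace_eq_sum_inner AL b,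
        Finset.mul_sum]
      refine Finset.sum_congr rfl fun i _ => ?_
      rw [addAdjoint_apply, inner_add_right, LinearMap.adjoint_inner_right, real_inner_comm]; ring
    rw [← Fin.sum_univ_three, ← h1, h2, htr, mul_zero]
  -- the strain operator acts diagonally in the eigenbasis
  set S := (1 / 2 : ℝ) • (A + ContinuousLinearMap.adjoint A) with hS
  have hSb : ∀ i, S (b i) = (μ i / 2) • b i := by
    intro i
    have h := hTb i
    rw [addAdjoint_apply] at h
    change A (b i) + ContinuousLinearMap.adjoint A (b i) = μ i • b i at h
    have h2 : S (b i) = (1 / 2 : ℝ) • (A (b i) + ContinuousLinearMap.adjoint A (b i)) := by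
      simp only [hS, FunLike.coe_smul, FunLike.coe_add, Pi.smul_apply, Pi.add_apply]
    rw [h2, h, smul_smul]
    congr 1; ring
  have hdet : S.det = (μ 0 / 2) * (μ 1 / 2) * (μ 2 / 2) := by
    have hM : LinearMap.toMatrix b.toBasis b.toBasis (S : EuclideanSpace ℝ (Fin 3) →ₗ[ℝ] _) =
        Matrix.diagonal fun i => μ i / 2 := by
      ext i j
      rw [LinearMap.toMatrix_apply, ContinuousLinearMap.coe_coe, OrthonormalBasis.coe_toBasis, hSb,
        OrthonormalBasis.coe_toBasis_repr_apply, map_smul, b.repr_self, Matrix.diagonal_apply]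
      by_cases hij : i = j
      · subst hij; simp
      · simp [hij]
    rw [ContinuousLinearMap.det, ← LinearMap.det_toMatrix b.toBasis, hM, Matrix.det_diagonal,
      Fin.prod_univ_three]
  rw [hmid, hdet]
  have hab : μ 1 / 2 ≤ μ 0 / 2 := by linarith
  have hs : μ 0 / 2 + μ 1 / 2 + μ 2 / 2 = 0 := by linarith
  exact max_mid_pow_three_le hab hs

/-- **The middle principal strain against the Betchov charge, at a divergence-free point.** If `div v (x) = 0`
then `(λ₂(∇v(x))⁺)³ ≤ Q⁺ / 8` with `Q = ⟪ω, ∇v ω⟫ − 4 det ∇v = −4 det S` (`ω = curl v x`).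
[cite: Betchov1956, §3] [cite: Miller2019, Lemma 5.1] -/
theorem middleStrain_pos_pow_three_le_charge (v : EuclideanSpace ℝ (Fin 3) → EuclideanSpace ℝ (Fin 3))
    (x : EuclideanSpace ℝ (Fin 3)) (hdiv : VectorCalculus.divergence v x = 0) :
    max (strainEigenvalues ((fderiv ℝ v x : EuclideanSpace ℝ (Fin 3) →L[ℝ] EuclideanSpace ℝ (Fin 3)) :
        EuclideanSpace ℝ (Fin 3) →ₗ[ℝ] EuclideanSpace ℝ (Fin 3)) finrank_euclideanSpace_fin 1) 0 ^ 3 ≤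
      max (⟪curl v x, fderiv ℝ v x (curl v x)⟫ - 4 * (fderiv ℝ v x).det) 0 / 8 := by
  have h := middleStrain_pos_pow_three_le (fderiv ℝ v x) hdiv
  rw [inner_curl_sub_four_det]
  have key : max (-4 * ((1 / 2 : ℝ) • (fderiv ℝ v x + ContinuousLinearMap.adjoint (fderiv ℝ v x))).det) 0 / 8 =
      max (-((1 / 2 : ℝ) • (fderiv ℝ v x + ContinuousLinearMap.adjoint (fderiv ℝ v x))).det) 0 / 2 := by
    set d := ((1 / 2 : ℝ) • (fderiv ℝ v x + ContinuousLinearMap.adjoint (fderiv ℝ v x))).det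
    rcases le_or_gt 0 (-d) with hd | hd
    · rw [max_eq_left hd, max_eq_left (by linarith)]; ring
    · rw [max_eq_right hd.le, max_eq_right (by linarith), zero_div, zero_div]
  rw [key]
  exact h

/-- The clipped middle strain in `ℝ≥0∞`: `(ofReal λ₂(∇v(x)))^3 ≤ ofReal Q(x)` at a divergence-free point
(`ofReal` clips at `0`; the factor `1/8` is dropped). [cite: Miller2019, Lemma 5.1] -/
theorem ofReal_middleStrain_rpow_three_le (v : EuclideanSpace ℝ (Fin 3) → EuclideanSpace ℝ (Fin 3))
    (x : EuclideanSpace ℝ (Fin 3)) (hdiv : VectorCalculus.divergence v x = 0) :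
    ENNReal.ofReal (strainEigenvalues ((fderiv ℝ v x : EuclideanSpace ℝ (Fin 3) →L[ℝ] EuclideanSpace ℝ (Fin 3)) :
        EuclideanSpace ℝ (Fin 3) →ₗ[ℝ] EuclideanSpace ℝ (Fin 3)) finrank_euclideanSpace_fin 1) ^ (3 : ℝ) ≤
      ENNReal.ofReal (⟪curl v x, fderiv ℝ v x (curl v x)⟫ - 4 * (fderiv ℝ v x).det) := by
  set lam := strainEigenvalues ((fderiv ℝ v x : EuclideanSpace ℝ (Fin 3) →L[ℝ] EuclideanSpace ℝ (Fin 3)) :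
        EuclideanSpace ℝ (Fin 3) →ₗ[ℝ] EuclideanSpace ℝ (Fin 3)) finrank_euclideanSpace_fin 1 with hlam
  set Q := ⟪curl v x, fderiv ℝ v x (curl v x)⟫ - 4 * (fderiv ℝ v x).det with hQ
  have h := middleStrain_pos_pow_three_le_charge v x hdiv
  rw [← hlam, ← hQ] at h
  have h0 : 0 ≤ max lam 0 := le_max_right _ _
  calc ENNReal.ofReal lam ^ (3 : ℝ)
      = ENNReal.ofReal lam ^ (3 : ℕ) := by
        rw [show (3 : ℝ) = ((3 : ℕ) : ℝ) by norm_num, ENNReal.rpow_natCast]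
    _ ≤ ENNReal.ofReal (max lam 0) ^ (3 : ℕ) := by
        gcongr
        exact le_max_left _ _
    _ = ENNReal.ofReal (max lam 0 ^ 3) := (ENNReal.ofReal_pow h0 3).symm
    _ ≤ ENNReal.ofReal (max Q 0 / 8) := ENNReal.ofReal_le_ofReal h
    _ ≤ ENNReal.ofReal Q := by
        rcases le_or_gt 0 Q with hq | hq
        · rw [max_eq_left hq]
          exact ENNReal.ofReal_le_ofReal (by linarith)
        · rw [max_eq_right hq.le, zero_div, ENNReal.ofReal_zero]
          exact bot_le

/-! ### §2 One flow: the charge gives the `q = 3` window of the crux -/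

/-- `x^{2/3} ≤ 1 + x` in `ℝ≥0∞`. [folklore] -/
theorem rpow_two_thirds_le_one_add (x : ℝ≥0∞) : x ^ (2 / 3 : ℝ) ≤ 1 + x := by
  rcases le_or_gt x 1 with hx | hx
  · exact (ENNReal.rpow_le_one hx (by norm_num)).trans le_self_add
  · calc x ^ (2 / 3 : ℝ) ≤ x ^ (1 : ℝ) := ENNReal.rpow_le_rpow_of_exponent_le hx.le (by norm_num)
      _ = x := ENNReal.rpow_one x
      _ ≤ 1 + x := le_add_self

/-- **One flow: the fast-class Betchov charge gives the `q = 3` window of the crux.** Along a classical solution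
of unforced Navier–Stokes on `ℝ³ × [0,T)`: if `∫₀ᵀ ∫_{|u(t)|>l} Q⁺ < ∞` at a level `l` (`Q = ⟪ω,∇u ω⟫ − 4 det ∇u`),
then with `m := λ₂(∇u)⁺` (nonnegative, realising the min–max clause by Courant–Fischer) one has
`∫₀ᵀ (∫_{|u(t)|>l} m³)^{2/3} dt < ∞` — the crux's conclusion for this flow with `q = 3`.
[cite: Miller2019, Thm 1.1 and Lemma 5.1] -/
theorem window_of_charge {ν T : ℝ} {u : ℝ → EuclideanSpace ℝ (Fin 3) → EuclideanSpace ℝ (Fin 3)}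
    {p : ℝ → EuclideanSpace ℝ (Fin 3) → ℝ} (hcl : IsClassicalNSSolutionOn (Ico 0 T) ν 0 u p) {l : ℝ}
    (hcharge : ∫⁻ t in Ioo 0 T, ∫⁻ x in {x : EuclideanSpace ℝ (Fin 3) | l < ‖u t x‖},
      ENNReal.ofReal (⟪curl (u t) x, fderiv ℝ (u t) x (curl (u t) x)⟫ - 4 * (fderiv ℝ (u t) x).det) < ⊤) :
    ∃ m : ℝ → EuclideanSpace ℝ (Fin 3) → ℝ, (∀ t x, 0 ≤ m t x) ∧
      (∀ t ∈ Ico 0 T, ∀ x, l < ‖u t x‖ → ∃ v w : EuclideanSpace ℝ (Fin 3),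
        ‖v‖ = 1 ∧ ‖w‖ = 1 ∧ inner ℝ v w = 0 ∧
        ∀ α β : ℝ, inner ℝ (fderiv ℝ (u t) x (α • v + β • w)) (α • v + β • w) ≤ m t x * (α ^ 2 + β ^ 2)) ∧
      ∫⁻ t in Ioo 0 T, (∫⁻ x in {x : EuclideanSpace ℝ (Fin 3) | l < ‖u t x‖},
        ENNReal.ofReal (m t x) ^ (3 : ℝ)) ^ (2 / (2 * 3 - 3) : ℝ) < ⊤ := by
  -- the majorant `m = λ₂⁺`
  set lam : ℝ → EuclideanSpace ℝ (Fin 3) → ℝ := fun t x => strainEigenvalues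
      ((fderiv ℝ (u t) x : EuclideanSpace ℝ (Fin 3) →L[ℝ] EuclideanSpace ℝ (Fin 3)) :
        EuclideanSpace ℝ (Fin 3) →ₗ[ℝ] EuclideanSpace ℝ (Fin 3)) finrank_euclideanSpace_fin 1 with hlam
  set Q : ℝ → EuclideanSpace ℝ (Fin 3) → ℝ := fun t x =>
      ⟪curl (u t) x, fderiv ℝ (u t) x (curl (u t) x)⟫ - 4 * (fderiv ℝ (u t) x).det with hQ
  refine ⟨fun t x => max (lam t x) 0, fun t x => le_max_right _ _, ?_, ?_⟩
  · intro t _ x _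
    exact (middleStrain_le_iff _ _).1 (le_max_left _ _)
  · -- `ofReal (max λ 0) = ofReal λ`
    have heq : ∀ t x, ENNReal.ofReal (max (lam t x) 0) = ENNReal.ofReal (lam t x) := by
      intro t x
      rcases le_or_gt 0 (lam t x) with h | h
      · rw [max_eq_left h]
      · rw [max_eq_right h.le, ENNReal.ofReal_zero, ENNReal.ofReal_of_nonpos h.le]
    simp only [heq]
    have hexp : (2 / (2 * 3 - 3) : ℝ) = 2 / 3 := by norm_num
    rw [hexp]
    -- slice by slice: `(∫_F (ofReal λ)^3)^{2/3} ≤ 1 + ∫_F ofReal Q` for `t ∈ (0,T)`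
    have hslice : ∀ t ∈ Ioo 0 T,
        (∫⁻ x in {x : EuclideanSpace ℝ (Fin 3) | l < ‖u t x‖}, ENNReal.ofReal (lam t x) ^ (3 : ℝ)) ^ (2 / 3 : ℝ) ≤
          1 + ∫⁻ x in {x : EuclideanSpace ℝ (Fin 3) | l < ‖u t x‖}, ENNReal.ofReal (Q t x) := by
      intro t ht
      refine (rpow_two_thirds_le_one_add _).trans (add_le_add le_rfl (lintegral_mono fun x => ?_))
      exact ofReal_middleStrain_rpow_three_le (u t) x (hcl.divFree t (Ioo_subset_Ico_self ht) x)
    calc ∫⁻ t in Ioo 0 T, (∫⁻ x in {x : EuclideanSpace ℝ (Fin 3) | l < ‖u t x‖},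
            ENNReal.ofReal (lam t x) ^ (3 : ℝ)) ^ (2 / 3 : ℝ)
        ≤ ∫⁻ t in Ioo 0 T, (1 + ∫⁻ x in {x : EuclideanSpace ℝ (Fin 3) | l < ‖u t x‖}, ENNReal.ofReal (Q t x)) :=
          setLIntegral_mono' measurableSet_Ioo fun t ht => hslice t ht
      _ = ∫⁻ _ in Ioo 0 T, (1 : ℝ≥0∞) ∂volume +
            ∫⁻ t in Ioo 0 T, ∫⁻ x in {x : EuclideanSpace ℝ (Fin 3) | l < ‖u t x‖}, ENNReal.ofReal (Q t x) :=
          lintegral_add_left measurable_const _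
      _ < ⊤ := by
          refine ENNReal.add_lt_top.2 ⟨?_, hcharge⟩
          rw [setLIntegral_const, one_mul, Real.volume_Ioo]
          exact ENNReal.ofReal_lt_top

/-! ### §3 The transfers -/

/-- **`FastClassCharge → FastClassSqueeze`.** If along every classical solution of unforced Navier–Stokes on
`ℝ³ × [0,T)` that is Leray–Hopf from a rapidly decaying datum the Betchov charge of some fast class is finite,
`∃ l > 0, ∫₀ᵀ ∫_{|u(t)|>l} Q⁺ dx dt < ∞` (`Q = ⟪ω,∇u ω⟫ − 4 det ∇u = −4 det S`), then `FastClassSqueeze` holds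
(with `q = 3`, `m = λ₂⁺`). [cite: Miller2019, Thm 1.1 and Lemma 5.1] [cite: Betchov1956, §3] -/
theorem fastClassSqueeze_of_fastClassCharge : (∀ (ν T : ℝ), 0 < ν → 0 < T → ∀ (u : ℝ → EuclideanSpace ℝ (Fin 3) → EuclideanSpace ℝ (Fin 3)) (p : ℝ → EuclideanSpace ℝ (Fin 3) → ℝ), Literature.Analysis.FluidPDE.IsClassicalNSSolutionOn (Set.Ico 0 T) ν 0 u p → Literature.Analysis.FluidPDE.IsLerayHopfOn T ν 0 (u 0) u → Literature.Analysis.FluidPDE.HasRapidSpatialDecay (u 0) → ∃ l : ℝ, 0 < l ∧ ∫⁻ t in Set.Ioo 0 T, ∫⁻ x in {x : EuclideanSpace ℝ (Fin 3) | l < ‖u t x‖}, ENNReal.ofReal (inner ℝ (Literature.Analysis.FluidPDE.curl (u t) x) (fderiv ℝ (u t) x (Literature.Analysis.FluidPDE.curl (u t) x)) - 4 * (fderiv ℝ (u t) x).det) < ⊤) → Summit.NavierStokesRegularity.NavierStokesRegularity.Theses.HodographBetchov.FastClassSqueeze := by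
  intro h ν T hν hT u p hcl hLH hdec
  obtain ⟨l, hl, hcharge⟩ := h ν T hν hT u p hcl hLH hdec
  obtain ⟨m, hm0, hclause, hint⟩ := window_of_charge hcl hcharge
  exact ⟨l, hl, 3, by norm_num, m, hm0, hclause, hint⟩

/-- **The charge closes the open stub of line `Sketch-ideasK1`.** `FastClassCharge` implies the registered stub
`stub_pointSubscaleSqueeze` (verbatim its signature as conclusion): the `q = 3` window of the crux given by
`window_of_charge`, fed to the landed window converse `GermWeyl.pointSubscaleSqueeze_of_fastClassSqueezeWindow`.
[cite: Miller2019, Thm 1.1] -/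
theorem pointSubscaleSqueeze_of_fastClassCharge
    (h : ∀ (ν T : ℝ), 0 < ν → 0 < T →
      ∀ (u : ℝ → EuclideanSpace ℝ (Fin 3) → EuclideanSpace ℝ (Fin 3)) (p : ℝ → EuclideanSpace ℝ (Fin 3) → ℝ),
      IsClassicalNSSolutionOn (Ico 0 T) ν 0 u p → IsLerayHopfOn T ν 0 (u 0) u → HasRapidSpatialDecay (u 0) →
      ∃ l : ℝ, 0 < l ∧ ∫⁻ t in Ioo 0 T, ∫⁻ x in {x : EuclideanSpace ℝ (Fin 3) | l < ‖u t x‖},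
        ENNReal.ofReal (⟪curl (u t) x, fderiv ℝ (u t) x (curl (u t) x)⟫ - 4 * (fderiv ℝ (u t) x).det) < ⊤) :
    ∀ (ν T : ℝ), 0 < ν → 0 < T →
      ∀ (u : ℝ → EuclideanSpace ℝ (Fin 3) → EuclideanSpace ℝ (Fin 3)) (p : ℝ → EuclideanSpace ℝ (Fin 3) → ℝ),
      Literature.Analysis.FluidPDE.IsClassicalNSSolutionOn (Set.Ico 0 T) ν 0 u p →
      Literature.Analysis.FluidPDE.IsLerayHopfOn T ν 0 (u 0) u →
      Literature.Analysis.FluidPDE.HasRapidSpatialDecay (u 0) →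
      ∃ q : ℝ, 3 ≤ q ∧ ∀ x₀ : EuclideanSpace ℝ (Fin 3),
        Literature.Analysis.FluidPDE.IsBackwardSingularPoint u (T, x₀) →
        ∃ r : ℝ, 0 < r ∧ ∃ R : ℝ, 0 < R ∧ ∃ τ : ℝ, 0 ≤ τ ∧ τ < T ∧ ∃ l : ℝ, 0 < l ∧
          ∫⁻ t in Set.Ioo τ T, (∫⁻ x in {x : EuclideanSpace ℝ (Fin 3) | l < ‖u t x‖} ∩ Metric.ball x₀ r,
            ENNReal.ofReal (Literature.Analysis.FluidPDE.strainEigenvalues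
              ((fderiv ℝ (u t) x - ⨍ y in Metric.closedBall x R, fderiv ℝ (u t) y :
                  EuclideanSpace ℝ (Fin 3) →L[ℝ] EuclideanSpace ℝ (Fin 3)) :
                EuclideanSpace ℝ (Fin 3) →ₗ[ℝ] EuclideanSpace ℝ (Fin 3))
              finrank_euclideanSpace_fin 1) ^ q) ^ (2 / (2 * q - 3)) < ⊤ := by
  refine GermWeyl.pointSubscaleSqueeze_of_fastClassSqueezeWindow ?_
  intro ν T hν hT u p hcl hLH hdec
  obtain ⟨l, hl, hcharge⟩ := h ν T hν hT u p hcl hLH hdec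
  obtain ⟨m, hm0, hclause, hint⟩ := window_of_charge hcl hcharge
  refine ⟨l, hl, 3, le_rfl, m, hm0, hclause, ?_⟩
  simpa using hint

/-! ### §4 The scale-invariant form of the charge hypothesis -/

/-- **One flow, scale-invariant form: the `2/3`-power charge gives the `q = 3` window of the crux (no loss).**
Along a classical solution of unforced Navier–Stokes on `ℝ³ × [0,T)`: if
`∫₀ᵀ (∫_{|u(t)|>l} Q⁺ dx)^{2/3} dt < ∞` at a level `l` (`Q = ⟪ω,∇u ω⟫ − 4 det ∇u`; this functional is invariant
under `u ↦ μ u(μ² t, μ x)`), then with `m := λ₂(∇u)⁺` one has `∫₀ᵀ (∫_{|u(t)|>l} m³)^{2/3} dt < ∞` — the crux's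
conclusion for this flow with `q = 3` (slice by slice `(∫_F (ofReal λ₂)³)^{2/3} ≤ (∫_F ofReal Q)^{2/3}`).
[cite: Miller2019, Thm 1.1 and Lemma 5.1] -/
theorem window_of_criticalCharge {ν T : ℝ} {u : ℝ → EuclideanSpace ℝ (Fin 3) → EuclideanSpace ℝ (Fin 3)}
    {p : ℝ → EuclideanSpace ℝ (Fin 3) → ℝ} (hcl : IsClassicalNSSolutionOn (Ico 0 T) ν 0 u p) {l : ℝ}
    (hcharge : ∫⁻ t in Ioo 0 T, (∫⁻ x in {x : EuclideanSpace ℝ (Fin 3) | l < ‖u t x‖},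
      ENNReal.ofReal (⟪curl (u t) x, fderiv ℝ (u t) x (curl (u t) x)⟫ - 4 * (fderiv ℝ (u t) x).det)) ^
        (2 / 3 : ℝ) < ⊤) :
    ∃ m : ℝ → EuclideanSpace ℝ (Fin 3) → ℝ, (∀ t x, 0 ≤ m t x) ∧
      (∀ t ∈ Ico 0 T, ∀ x, l < ‖u t x‖ → ∃ v w : EuclideanSpace ℝ (Fin 3),
        ‖v‖ = 1 ∧ ‖w‖ = 1 ∧ inner ℝ v w = 0 ∧
        ∀ α β : ℝ, inner ℝ (fderiv ℝ (u t) x (α • v + β • w)) (α • v + β • w) ≤ m t x * (α ^ 2 + β ^ 2)) ∧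
      ∫⁻ t in Ioo 0 T, (∫⁻ x in {x : EuclideanSpace ℝ (Fin 3) | l < ‖u t x‖},
        ENNReal.ofReal (m t x) ^ (3 : ℝ)) ^ (2 / (2 * 3 - 3) : ℝ) < ⊤ := by
  set lam : ℝ → EuclideanSpace ℝ (Fin 3) → ℝ := fun t x => strainEigenvalues
      ((fderiv ℝ (u t) x : EuclideanSpace ℝ (Fin 3) →L[ℝ] EuclideanSpace ℝ (Fin 3)) :
        EuclideanSpace ℝ (Fin 3) →ₗ[ℝ] EuclideanSpace ℝ (Fin 3)) finrank_euclideanSpace_fin 1 with hlam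
  set Q : ℝ → EuclideanSpace ℝ (Fin 3) → ℝ := fun t x =>
      ⟪curl (u t) x, fderiv ℝ (u t) x (curl (u t) x)⟫ - 4 * (fderiv ℝ (u t) x).det with hQ
  refine ⟨fun t x => max (lam t x) 0, fun t x => le_max_right _ _, ?_, ?_⟩
  · intro t _ x _
    exact (middleStrain_le_iff _ _).1 (le_max_left _ _)
  · have heq : ∀ t x, ENNReal.ofReal (max (lam t x) 0) = ENNReal.ofReal (lam t x) := by
      intro t x
      rcases le_or_gt 0 (lam t x) with h | h
      · rw [max_eq_left h]
      · rw [max_eq_right h.le, ENNReal.ofReal_zero, ENNReal.ofReal_of_nonpos h.le]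
    simp only [heq]
    have hexp : (2 / (2 * 3 - 3) : ℝ) = 2 / 3 := by norm_num
    rw [hexp]
    refine lt_of_le_of_lt (setLIntegral_mono' measurableSet_Ioo fun t ht => ?_) hcharge
    refine ENNReal.rpow_le_rpow (lintegral_mono fun x => ?_) (by norm_num)
    exact ofReal_middleStrain_rpow_three_le (u t) x (hcl.divFree t (Ioo_subset_Ico_self ht) x)

/-- **The `L¹` charge implies the scale-invariant charge on the finite interval** (`x^{2/3} ≤ 1 + x` slice by
slice and `|(0,T)| < ∞`), so `window_of_charge` is a corollary of `window_of_criticalCharge`. [folklore] -/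
theorem criticalCharge_lt_top_of_charge {T : ℝ} {G : ℝ → ℝ≥0∞}
    (hG : ∫⁻ t in Ioo 0 T, G t < ⊤) : ∫⁻ t in Ioo 0 T, G t ^ (2 / 3 : ℝ) < ⊤ := by
  calc ∫⁻ t in Ioo 0 T, G t ^ (2 / 3 : ℝ) ≤ ∫⁻ t in Ioo 0 T, (1 + G t) :=
        lintegral_mono fun t => rpow_two_thirds_le_one_add _
    _ = ∫⁻ _ in Ioo 0 T, (1 : ℝ≥0∞) ∂volume + ∫⁻ t in Ioo 0 T, G t := lintegral_add_left measurable_const _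
    _ < ⊤ := by
        refine ENNReal.add_lt_top.2 ⟨?_, hG⟩
        rw [setLIntegral_const, one_mul, Real.volume_Ioo]
        exact ENNReal.ofReal_lt_top

/-- **`CriticalFastClassCharge → FastClassSqueeze` (scale-invariant transfer).** If along every classical solution
of unforced Navier–Stokes on `ℝ³ × [0,T)` that is Leray–Hopf from a rapidly decaying datum some fast class has
`∫₀ᵀ (∫_{|u(t)|>l} Q⁺ dx)^{2/3} dt < ∞` (`Q = ⟪ω,∇u ω⟫ − 4 det ∇u = −4 det S`), then `FastClassSqueeze` holds
(`q = 3`, `m = λ₂⁺`). This hypothesis has the strength of the `q = 3` window of the crux itself (log-divergent, not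
power-divergent, in a self-similar-rate collapse). [cite: Miller2019, Thm 1.1 and Lemma 5.1] [cite: Betchov1956, §3] -/
theorem fastClassSqueeze_of_criticalFastClassCharge : (∀ (ν T : ℝ), 0 < ν → 0 < T → ∀ (u : ℝ → EuclideanSpace ℝ (Fin 3) → EuclideanSpace ℝ (Fin 3)) (p : ℝ → EuclideanSpace ℝ (Fin 3) → ℝ), Literature.Analysis.FluidPDE.IsClassicalNSSolutionOn (Set.Ico 0 T) ν 0 u p → Literature.Analysis.FluidPDE.IsLerayHopfOn T ν 0 (u 0) u → Literature.Analysis.FluidPDE.HasRapidSpatialDecay (u 0) → ∃ l : ℝ, 0 < l ∧ ∫⁻ t in Set.Ioo 0 T, (∫⁻ x in {x : EuclideanSpace ℝ (Fin 3) | l < ‖u t x‖}, ENNReal.ofReal (inner ℝ (Literature.Analysis.FluidPDE.curl (u t) x) (fderiv ℝ (u t) x (Literature.Analysis.FluidPDE.curl (u t) x)) - 4 * (fderiv ℝ (u t) x).det)) ^ (2 / 3 : ℝ) < ⊤) → Summit.NavierStokesRegularity.NavierStokesRegularity.Theses.HodographBetchov.FastClassSqueeze := by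
  intro h ν T hν hT u p hcl hLH hdec
  obtain ⟨l, hl, hcharge⟩ := h ν T hν hT u p hcl hLH hdec
  obtain ⟨m, hm0, hclause, hint⟩ := window_of_criticalCharge hcl hcharge
  exact ⟨l, hl, 3, by norm_num, m, hm0, hclause, hint⟩

end Summit.NavierStokesRegularity.NavierStokesRegularity.Theorems.FastClassSqueeze.Charge

end
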